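import Summits.BirchSwinnertonDyer.BirchSwinnertonDyer.Theorems.ErratumRoadFiveIMCDivAtomsB
import Summits.BirchSwinnertonDyer.BirchSwinnertonDyer.Theorems.EisensteinPrimesBSDpOnCellCLogSymmetry
import Summits.BirchSwinnertonDyer.Rank1Residual.X11b.BDPRouteErratumData
import Summits.BirchSwinnertonDyer.Rank1Residual.X11b.BDPRouteLocalIndexTransport
import HarnessLib

/-!
# Route `ErratumRoadFive` (rung K2, `p ≥ 5`), crux `IMCDivAtErratumDataAll` (item stmt-BirchSwinnertonDyer-19270, H3♭):
# the T = 0 RE-THREAD of the re-oriented atom — (T0) log-symmetry at erratum data, route p2's pointwise open input and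
# the `≥`-half of Castella's display (5.3) from `P2.IMCDivIntFrameAtErratumDataB` (X-slot at the OTHER prime)

Cell `bsd-stepL` (run/shared/lean/pub/bsd-stepL/), seat `bsd-stepL-imc24b` (prover g4, 2026-08-27); `--supports
stmt-BirchSwinnertonDyer-19270 --as helper`; Theses-free. Deliverable (G2, first half) of planner g30's RULING 1
(STATUS 2026-08-27T02:49:25Z): `X11b/BDPRouteErratumData.lean` §4 RUN AT THE OTHER PRIME, as prescribed by the REPAIR
TEXT Q4 (T0) of `HOME/audit/ORIENT-AUDIT-19270-imc-p1-g8.md`.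

## The point

After repair (a) the divisibility conjunct of the crux's atom speaks about `XAc (W.baseChange K) p κ 𝔭bar ∅ γ` for a
prime `𝔭bar ∋ p` OTHER than the frame's prime `𝔭_{ι′}`, while the value conjunct `Q(𝟙) = u·((1 − a_p p⁻¹)·log P)²` reads
the logarithm through the embedding `e ↔ 𝔭_{ι′}`. Route p2's pointwise open input `IMCLowerWaldspurgerOnTreeAt p κ 𝔭 γ ι P`
(`2·(ord_p log_ι P − 1) ≤ ord_p f(0)`, `f` a generator of `Ch_Λ(XAc … 𝔭 ∅ γ)`) couples the X-slot `𝔭` with CTL₀ at `𝔭`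
(`controlUpperOnTreeAt_of_isErratumField`, available at EVERY degree-one prime) and with the logarithm along `ι`. So at a
given degree-one `𝔭` one takes the frame at the OTHER prime `𝔮` (`𝔮 = 𝔭_{ι′}` for `ι′ ∈ {ι, ι ∘ conj}`,
`eq_primeOfEmbeddingDatum_or_eq_trans_starRingAut`; `𝔮 ≠ 𝔭` by `exists_conj_prime_of_splitsIn`), reads the value through
`embAt K p 𝔮`, takes the divisibility for the X-slot `𝔭bar := 𝔭`, and moves the resulting inequality from `log_𝔮` to
`log_𝔭` by (T0): **in rank one `ord_p log_{ω_E} P` does not depend on the embedding `K ↪ ℚ_p`** — which the `bsd-eis`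
cell proved as `LogSymmetry.padicLogOrd_eq_of_finrank_eq_two` (`Theorems/EisensteinPrimesBSDpOnCellCLogSymmetry.lean`,
seat bsd-eis-cgshw g12, over the b2b cell's `padicLogOrd_comp_eq_of_rank_one`): cited BY NAME, not restated; here only
instantiated at erratum data (`rank E(K) = 1` by `IsErratumField.mordellWeilRank_eq_one_and_shaFinite` + GZK).

## What this file proves (theorems only; no definition, no named fact, no `sorry`)

* §1 (T0) **`R1.padicLogOrd_eq_of_isErratumField`** — at erratum data (`IsErratumField W K q`, `r_an(E) = 1`, `p ≠ 2`,
  `P` of infinite order), `padicLogOrd W p e' P = padicLogOrd W p e P` for ANY two embeddings `e e' : K →+* ℚ_p`; the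
  `embAt` form **`R1.padicLogOrd_embAt_eq_embAt_of_isErratumField`** (the audit's display); the transport
  `imcLowerWaldspurgerOnTreeAt_of_padicLogOrd_eq_emb` of route p2's link along an equality of `padicLogOrd` in the
  embedding slot (the `P`-slot transport is multr1-p2's `imcLowerWaldspurgerOnTreeAt_of_padicLogOrd_eq`).
* §2 **`imcLowerWaldspurgerOnTreeAt_of_imcDivIntFrameAtErratumDataB`** — the re-oriented twin of
  `imcLowerWaldspurgerOnTreeAt_of_imcDivIntFrameAtErratumData` (BDPRouteErratumData §4): SAME conclusion
  `IMCLowerWaldspurgerOnTreeAt p κ 𝔭 γ (embAt K p 𝔭 …) P` at EVERY degree-one `𝔭 ∋ p`, from the B-shape with value.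
* §3 **`display53Lower_of_imcDivIntFrameAtErratumDataB`** — the `≥`-half (A≥) of Castella's display (5.3) at an erratum
  datum, `2·ord_p[E(K):ℤP] − ord_p ∏_w c_w(E/K) ≤ ord_p #Ш(E/K)[p^∞]`, from the B-shape (verbatim the A-proof over §2) —
  the ONLY place the A-atom enters imc-p1's `missingLowerBoundAt_of_erratumHypotheses_of_imcDivIntFrameAtErratumData`,
  so the class-level kernel re-threads in the companion file `ErratumRoadFiveKernelUpperFromPrintB`.

HONEST FRAMING: CONDITIONAL on the re-oriented one-sided shape (OPEN; erratum (2.4) ⇐ [FW21, Thm. 4.41] + Hida descent,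
PREPRINT) and on the cited PT/EP facts and GZK/modularity binders exactly as the A-versions; nothing is booked; X11b stays
CONSTRUCTION-SHAPED; BSD is proved for no pair.

References: [Castella2018] Thm. 2.3, Thms. 3.1–3.2, §5 (5.1)–(5.3) (arXiv:1704.06608 pp. 5, 9, 12); [Castella2018Erratum]
(2.4) (p. 4); [JetchevSkinnerWan2017] §2.3.2, §7.4.1 (arXiv:1512.06894 pp. 7, 30); [CastellaGrossiLeeSkinner2022] Thm. 5.1.1
(log at the prime induced by `ι_p`, module strict at `v̄`); [MilneADT2006] I.4.10(b), I.2.8; [GreenbergLNM1716] L.3.3.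
-/

set_option autoImplicit false

noncomputable section

open scoped Classical

open WeierstrassCurve NumberField IsDedekindDomain Field PowerSeries
open Literature.NumberTheory.EllipticCurves Literature.NumberTheory.EllipticCurves.GreenbergSelmer
open Literature.NumberTheory.EllipticCurves.ModularForms
open Literature.NumberTheory.EllipticCurves.Rank1Residual
open Literature.NumberTheory.EllipticCurves.Rank1Residual.Typed
open Literature.NumberTheory.EllipticCurves.Castella2018
open Literature.NumberTheory.GaloisRepresentations
open Literature.NumberTheory.GaloisCohomology
open Summit.BirchSwinnertonDyer.Rank1Residual.X11b.AcSelmer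
open Summit.BirchSwinnertonDyer.Rank1Residual.X11b.Halves
open Summit.BirchSwinnertonDyer.BirchSwinnertonDyer.Theorems

namespace Summit.BirchSwinnertonDyer.Rank1Residual.X11b

/-! ### §1 (T0): `ord_p log_{ω_E} P` is embedding-free at erratum data -/

section LogSymmetry

variable (W : WeierstrassCurve ℚ) [W.IsElliptic] [W.IsGloballyMinimal] (p : ℕ) [Fact p.Prime]
  {K : Type} [Field K] [NumberField K]

/-- **(T0) `ord_p log_{ω_E} P` does not depend on the embedding `K ↪ ℚ_p`, at erratum data.** For `W/ℚ` globally
minimal elliptic of analytic rank one, `p ≠ 2`, an erratum field `K` for `q` (imaginary quadratic with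
`L(E^{d_K}, 1) ≠ 0`, so `rank_ℤ E(K) = 1` by Gross–Zagier–Kolyvagin over `ℚ`: `IsErratumField.mordellWeilRank_eq_one_and_shaFinite`)
and `P ∈ E(K)` of infinite order: `padicLogOrd W p e' P = padicLogOrd W p e P` for ANY `e e' : K →+* ℚ_p` — the
`bsd-eis` cell's `LogSymmetry.padicLogOrd_eq_of_finrank_eq_two` (two embeddings of a quadratic field differ by an
involution `σ`; `σ_* P = ±P + torsion` in rank one; `log` kills torsion), instantiated. With `p = 𝔭𝔭̄` split this is
«`ord_p log_𝔭 P = ord_p log_𝔭̄ P`». [cite: CastellaGrossiLeeSkinner2022, Thm. 5.1.1 (the prime of the logarithm)]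
[cite: JetchevSkinnerWan2017, §7.4.1 (arXiv:1512.06894 p. 30)] -/
theorem R1.padicLogOrd_eq_of_isErratumField
    (hGZK : rank_eq_analyticRank_of_analyticRank_le_one) (hnf : exists_isNewformOf)
    (hr : W.analyticRank = 1) (hp : p ≠ 2) {q : ℕ} [Fact q.Prime] (hK : IsErratumField W K q)
    {P : (W.baseChange K).toAffine.Point} (hinf : ¬ IsOfFinAddOrder P) (e e' : K →+* ℚ_[p]) :
    padicLogOrd W p e' P = padicLogOrd W p e P :=
  LogSymmetry.padicLogOrd_eq_of_finrank_eq_two W p hp hK.1.1 e e'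
    (IsErratumField.mordellWeilRank_eq_one_and_shaFinite W hGZK hnf hr hK).1 P hinf

/-- **(T0), the audit's display: `padicLogOrd W p (embAt K p 𝔭bar …) P = padicLogOrd W p (embAt K p 𝔭 …) P`** for any
two degree-one primes `𝔭, 𝔭bar ∋ p` of an erratum field (the logarithm at `𝔭̄` versus at `𝔭`, Q4 (T0) of
ORIENT-AUDIT-19270). Special case of the previous theorem. [cite: CastellaGrossiLeeSkinner2022, Thm. 5.1.1] -/
theorem R1.padicLogOrd_embAt_eq_embAt_of_isErratumField
    (hGZK : rank_eq_analyticRank_of_analyticRank_le_one) (hnf : exists_isNewformOf)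
    (hr : W.analyticRank = 1) (hp : p ≠ 2) {q : ℕ} [Fact q.Prime] (hK : IsErratumField W K q)
    {P : (W.baseChange K).toAffine.Point} (hinf : ¬ IsOfFinAddOrder P)
    (𝔭 : HeightOneSpectrum (𝓞 K)) (h𝔭 : ((p : ℕ) : 𝓞 K) ∈ 𝔭.asIdeal)
    (he : 𝔭.asIdeal.ramificationIdx (𝓞 ℚ) = 1) (hf : 𝔭.asIdeal.inertiaDeg (𝓞 ℚ) = 1)
    (𝔭bar : HeightOneSpectrum (𝓞 K)) (h𝔭bar : ((p : ℕ) : 𝓞 K) ∈ 𝔭bar.asIdeal)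
    (hebar : 𝔭bar.asIdeal.ramificationIdx (𝓞 ℚ) = 1) (hfbar : 𝔭bar.asIdeal.inertiaDeg (𝓞 ℚ) = 1) :
    padicLogOrd W p (embAt K p 𝔭bar h𝔭bar hebar hfbar) P = padicLogOrd W p (embAt K p 𝔭 h𝔭 he hf) P :=
  R1.padicLogOrd_eq_of_isErratumField W p hGZK hnf hr hp hK hinf _ _

omit [W.IsElliptic] [W.IsGloballyMinimal] in
/-- Transport of route p2's one-sided link along an equality of `ord_p log` IN THE EMBEDDING SLOT (X-slot and `P`
fixed; the embedding enters the predicate only through `padicLogOrd`). [folklore] -/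
theorem imcLowerWaldspurgerOnTreeAt_of_padicLogOrd_eq_emb [W.IsElliptic] [W.IsGloballyMinimal]
    {κ : ZpExtension K p} {𝔭 : HeightOneSpectrum (𝓞 K)} {γ : Field.absoluteGaloisGroup K}
    [Fact (κ.IsTopGenerator γ)] {ι ι' : K →+* ℚ_[p]} {P : (W.baseChange K).toAffine.Point}
    (hlog : padicLogOrd W p ι' P = padicLogOrd W p ι P)
    (h : IMCLowerWaldspurgerOnTreeAt p κ 𝔭 γ ι' P) : IMCLowerWaldspurgerOnTreeAt p κ 𝔭 γ ι P := by
  obtain ⟨n, hn, hle⟩ := h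
  exact ⟨n, hn, by rw [← hlog]; exact hle⟩

end LogSymmetry

/-! ### §2 Route p2's pointwise open input at erratum data from the re-oriented shape -/

section Pointwise

variable {W : WeierstrassCurve ℚ} [W.IsElliptic] [W.IsGloballyMinimal] {p : ℕ} [Fact p.Prime]
  {K : Type} [Field K] [NumberField K]

/-- **Route p2's POINTWISE open input `(IMC≥∘BDP)ᵗ` AT AN ERRATUM DATUM from the RE-ORIENTED one-sided shape.** Same
data and same conclusion as multr1-p2's `imcLowerWaldspurgerOnTreeAt_of_imcDivIntFrameAtErratumData`: for `(W, p)` on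
the A′-hypotheses with `ord_{s=1} L(E,s) = 1`, a non-split multiplicative `E[p]`-ramified `q ≠ p`, an erratum field `K`
for `q` with [Cas20, §2.5]'s standing hypotheses, a Manin-good datum `Dt`, a Heegner point `P` of infinite order read
through ANY complex embedding `ιK`, anticyclotomic `(κ, γ)` and a degree-one `𝔭 ∋ p`:
`IMCLowerWaldspurgerOnTreeAt p κ 𝔭 γ (embAt K p 𝔭) P`. Proof: CTL₀ at `𝔭` (§3 of BDPRouteErratumData, any degree-one
prime); the OTHER prime `𝔮 ≠ 𝔭` above the split `p` (`LocalIndexTransport.exists_conj_prime_of_splitsIn`) is `𝔭_{ι′}` for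
`ι′ ∈ {ι, ι ∘ conj}` (`eq_primeOfEmbeddingDatum_or_eq_trans_starRingAut`); the B-shape at the datum read through `w₀`
(Galois bookkeeping `P' = τ_* P` verbatim from the A-proof), frame at `(ι′, 𝔮)`, value through `embAt K p 𝔮`, X-slot
`𝔭bar := 𝔭`; multr1-p1's one-sided assembly `R1.imcLowerWaldspurgerOnTreeAt_of_intValue_of_intDvd` (X-slot and
log-embedding are separate arguments); then `P' ↦ P` (`R1.padicLogOrd_map_eq_of_rank_one`) and `log_𝔮 ↦ log_𝔭` by (T0).
CONDITIONAL on the re-oriented shape (OPEN). [cite: Castella2018, Thms. 2.3, 3.1, 3.2 and §5 (arXiv:1704.06608 pp. 5, 9, 12)]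
[cite: Castella2018Erratum, (2.4) (p. 4)] [cite: CastellaGrossiLeeSkinner2022, Thm. 5.1.1] -/
theorem imcLowerWaldspurgerOnTreeAt_of_imcDivIntFrameAtErratumDataB
    (hGZK : rank_eq_analyticRank_of_analyticRank_le_one) (hnf : exists_isNewformOf)
    (hPT : ∀ (K : Type) [Field K] [NumberField K], poitouTate_sum_localTatePairing_eq_zero K)
    (hEP : ∀ (K : Type) [Field K] [NumberField K] (v : HeightOneSpectrum (𝓞 K)),
      localEulerPoincareCharacteristic (v.adicCompletion K))
    (ι : PadicAlgCl p ≃+* ℂ) (hD : P2.IMCDivIntFrameAtErratumDataB W p)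
    [NeZero (W.conductorNorm ℤ)] {q : ℕ} [Fact q.Prime]
    (Dt : ModularParametrizationData W (W.conductorNorm ℤ))
    (H : HeegnerDatum (W.conductorNorm ℤ) (NumberField.discr K)) (ιK : K →+* ℂ)
    {P : (W.baseChange K).toAffine.Point} (hE : ErratumHypotheses W p) (hr : W.analyticRank = 1)
    (hqp : q ≠ p) (hmq : Mult W q) (hns : ¬ W.HasSplitMultiplicativeReductionAtPrime q)
    (hvq : ¬ p ∣ padicValInt q W.minimalDiscriminantInt) (hK : IsErratumField W K q)
    (hCas : Cas20Standing K p (W.conductorNorm ℤ / p))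
    (hP : WeierstrassCurve.Affine.Point.map ιK.toRatAlgHom P = heegnerPointComplex Dt H)
    (hc : ¬ (p : ℤ) ∣ Dt.c) (hinf : ¬ IsOfFinAddOrder P)
    {κ : ZpExtension K p} (hκ : κ.IsAnticyclotomic) (γ : Field.absoluteGaloisGroup K)
    [Fact (κ.IsTopGenerator γ)]
    (𝔭 : HeightOneSpectrum (𝓞 K)) (h𝔭 : ((p : ℕ) : 𝓞 K) ∈ 𝔭.asIdeal)
    (he : 𝔭.asIdeal.ramificationIdx (𝓞 ℚ) = 1) (hf : 𝔭.asIdeal.inertiaDeg (𝓞 ℚ) = 1) :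
    IMCLowerWaldspurgerOnTreeAt p κ 𝔭 γ (embAt K p 𝔭 h𝔭 he hf) P := by
  -- the one-sided control at the datum supplies CTL₀ at the X-slot `𝔭`
  obtain ⟨n, hn, -⟩ := controlUpperOnTreeAt_of_isErratumField hGZK hnf hPT hEP hr hE.2.1 hE.2.2.1 hqp
    hK hinf hκ γ 𝔭 h𝔭 he hf
  obtain ⟨w₀⟩ := (inferInstance : Nonempty (InfinitePlace K))
  have hp2 : p ≠ 2 := hE.two_ne
  -- `rank_ℤ E(K) = 1` on the erratum field (Gross–Zagier–Kolyvagin over `ℚ`)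
  have hrk : (W.baseChange K).mordellWeilRank = 1 :=
    (IsErratumField.mordellWeilRank_eq_one_and_shaFinite W hGZK hnf hr hK).1
  -- the datum's complex embedding is `w₀.embedding ∘ τ` for some `τ ∈ Gal(K/ℚ)`, `τ² = 1`
  haveI : IsGalois ℚ K := by
    haveI : Algebra.IsQuadraticExtension ℚ K := ⟨hK.1.1⟩
    infer_instance
  obtain ⟨σ, hσ⟩ := ComplexEmbedding.exists_comp_symm_eq_of_comp_eq (k := ℚ) w₀.embedding ιK
    (by ext x; simp)
  set τ : K →+* K := ((σ.symm : K ≃ₐ[ℚ] K) : K →+* K) with hτdef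
  have hτ : ∀ x, τ (τ x) = x := by
    intro x
    have hcard : Nat.card (K ≃ₐ[ℚ] K) = 2 := by rw [IsGalois.card_aut_eq_finrank, hK.1.1]
    have hsq : σ.symm * σ.symm = 1 := by
      have h := pow_card_eq_one' (G := K ≃ₐ[ℚ] K) (x := σ.symm)
      rwa [hcard, pow_two] at h
    have := congrArg (fun g : K ≃ₐ[ℚ] K ↦ g x) hsq
    simpa [hτdef, AlgEquiv.mul_apply] using this
  -- the Galois conjugate `P' = τ_* P` is the Heegner point read through `w₀.embedding`
  set P' := WeierstrassCurve.Affine.Point.map τ.toRatAlgHom P with hP'def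
  have hP' : WeierstrassCurve.Affine.Point.map w₀.embedding.toRatAlgHom P' =
      heegnerPointComplex Dt H := by
    rw [hP'def, WeierstrassCurve.Affine.Point.map_map]
    have hcomp : w₀.embedding.toRatAlgHom.comp τ.toRatAlgHom = ιK.toRatAlgHom := by
      apply AlgHom.ext
      intro x
      have := RingHom.congr_fun hσ x
      simpa [hτdef] using this
    rw [hcomp]
    exact hP
  have hinf' : ¬ IsOfFinAddOrder P' := fun h ↦ hinf
    ((WeierstrassCurve.Affine.Point.map_injective (f := τ.toRatAlgHom)).isOfFinAddOrder_iff.mp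
      (by simpa [hP'def] using h))
  have hlogP : ∀ e : K →+* ℚ_[p], padicLogOrd W p e P' = padicLogOrd W p e P := fun e ↦
    R1.padicLogOrd_map_eq_of_rank_one W p e P hp2 τ hτ hrk hinf
  -- the OTHER prime `𝔮 ≠ 𝔭` above the split `p`, of degree one, and THE embedding at `𝔮`
  have hsplit : SplitsIn K p := hK.splitsIn_of_mult hE.2.1 (Ne.symm hqp)
  obtain ⟨-, 𝔮, -, h𝔮ne, h𝔮p, -⟩ := LocalIndexTransport.exists_conj_prime_of_splitsIn K p hK.1.1 hsplit h𝔭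
  obtain ⟨he', hf'⟩ := degreeOne_of_splitsIn hK.1.1 hsplit h𝔮p
  have hemb' : ∀ k : 𝓞 K, k ∈ 𝔮.asIdeal ↔ ‖embAt K p 𝔮 h𝔮p he' hf' (k : K)‖ < 1 :=
    mem_asIdeal_iff_norm_embAt_lt_one 𝔮 h𝔮p he' hf'
  -- (T0): the logarithm order at `𝔮` equals the one at `𝔭`
  have hlog𝔮 : padicLogOrd W p (embAt K p 𝔮 h𝔮p he' hf') P =
      padicLogOrd W p (embAt K p 𝔭 h𝔭 he hf) P :=
    R1.padicLogOrd_eq_of_isErratumField W p hGZK hnf hr hp2 hK hinf _ _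
  -- `𝔮` is induced by `ι` or by `ι ∘ conj`; the B-shape with frame at `(ι′, 𝔮)` and X-slot `𝔭`
  have key : ∀ ι' : PadicAlgCl p ≃+* ℂ, 𝔮 = primeOfEmbeddingDatum p ι' w₀.embedding →
      IMCLowerWaldspurgerOnTreeAt p κ 𝔭 γ (embAt K p 𝔭 h𝔭 he hf) P := by
    intro ι' h𝔮eq
    have hne : 𝔭 ≠ primeOfEmbeddingDatum p ι' w₀.embedding := fun h ↦ h𝔮ne (h𝔮eq.trans h.symm)
    have hemb'' : ∀ k : 𝓞 K, k ∈ (primeOfEmbeddingDatum p ι' w₀.embedding).asIdeal ↔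
        ‖embAt K p 𝔮 h𝔮p he' hf' (k : K)‖ < 1 := fun k ↦ by rw [← h𝔮eq]; exact hemb' k
    obtain ⟨ΩK, Ωp, Q, -, -, -, ⟨u, hu, hval⟩, h3At⟩ :=
      hD q K Dt H w₀ P' hE hr hqp hmq hns hvq hK hCas hP' hc hinf' κ hκ γ ι' _ hemb'' 𝔭 h𝔭 hne
    have h1 : IMCLowerWaldspurgerOnTreeAt p κ 𝔭 γ (embAt K p 𝔮 h𝔮p he' hf') P' :=
      R1.imcLowerWaldspurgerOnTreeAt_of_intValue_of_intDvd hn h3At (le_of_eq hu) (W.LFunction p) hval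
    have h2 : IMCLowerWaldspurgerOnTreeAt p κ 𝔭 γ (embAt K p 𝔮 h𝔮p he' hf') P :=
      imcLowerWaldspurgerOnTreeAt_of_padicLogOrd_eq W p _ (hlogP _) h1
    exact imcLowerWaldspurgerOnTreeAt_of_padicLogOrd_eq_emb W p hlog𝔮 h2
  rcases eq_primeOfEmbeddingDatum_or_eq_trans_starRingAut p ι hK.1 w₀ h𝔮p with h | h
  · exact key ι h
  · exact key _ h

/-! ### §3 The `≥`-half of Castella's display (5.3) at an erratum datum from the re-oriented shape -/

/-- **The `≥`-HALF of Castella's display (5.3) — (A≥) — AT AN ERRATUM DATUM from the RE-ORIENTED one-sided shape,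
`p ≥ 5`.** Same data and conclusion as multr1-p2's `display53Lower_of_imcDivIntFrameAtErratumData`:
`2·ord_p[E(K):ℤP] − ord_p ∏_w c_w(E/K) ≤ ord_p #Ш(E/K)[p^∞]`, from the pointwise input (§2) and the one-sided control at
ONE anticyclotomic `(κ, γ, 𝔭)` (both inequalities on `ord_p f_ac(0)` cancel, `two_mul_index_le_of_onTreeUpperLinks`),
and `ord_p ∏_{w∣N⁺} c_w = ord_p ∏_w c_w(E/K)` on an erratum field ((TAM-q)). The ONLY consumer-facing place the atom
enters the K2 kernel; the companion file re-threads the class-level theorem over it. CONDITIONAL on the re-oriented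
shape (OPEN). [cite: Castella2018, §5 (5.1)–(5.3) (arXiv:1704.06608 p. 12)]
[cite: JetchevSkinnerWan2017, §7.4.1 (eq:shalowerK-1) (arXiv:1512.06894 p. 30)] -/
theorem display53Lower_of_imcDivIntFrameAtErratumDataB
    (hGZK : rank_eq_analyticRank_of_analyticRank_le_one) (hnf : exists_isNewformOf)
    (hPT : ∀ (K : Type) [Field K] [NumberField K], poitouTate_sum_localTatePairing_eq_zero K)
    (hEP : ∀ (K : Type) [Field K] [NumberField K] (v : HeightOneSpectrum (𝓞 K)),
      localEulerPoincareCharacteristic (v.adicCompletion K))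
    (hD : P2.IMCDivIntFrameAtErratumDataB W p)
    [NeZero (W.conductorNorm ℤ)] {q : ℕ} [Fact q.Prime]
    (Dt : ModularParametrizationData W (W.conductorNorm ℤ))
    (H : HeegnerDatum (W.conductorNorm ℤ) (NumberField.discr K)) (ιK : K →+* ℂ)
    {P : (W.baseChange K).toAffine.Point} (hE : ErratumHypotheses W p) (hr : W.analyticRank = 1)
    (hqp : q ≠ p) (hmq : Mult W q) (hns : ¬ W.HasSplitMultiplicativeReductionAtPrime q)
    (hvq : ¬ p ∣ padicValInt q W.minimalDiscriminantInt) (hK : IsErratumField W K q)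
    (hCas : Cas20Standing K p (W.conductorNorm ℤ / p))
    (hP : WeierstrassCurve.Affine.Point.map ιK.toRatAlgHom P = heegnerPointComplex Dt H)
    (hc : ¬ (p : ℤ) ∣ Dt.c) (hinf : ¬ IsOfFinAddOrder P) :
    2 * (padicValNat p (AddSubgroup.zmultiples P).index : ℤ) -
        padicValNat p (W.baseChange K).tamagawaProduct ≤
      (padicValNat p (Nat.card (AddCommGroup.primaryComponent (W.baseChange K).sha p)) : ℤ) := by
  obtain ⟨ι⟩ := PadicAlgCl.nonempty_ringEquiv_complex p
  have hsplit : SplitsIn K p := hK.splitsIn_of_mult hE.2.1 (Ne.symm hqp)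
  obtain ⟨κ, γ, 𝔭, hκ, hγ, h𝔭⟩ := exists_anticyclotomic_generator_prime (p := p) hK.1
  haveI : Fact (κ.IsTopGenerator γ) := ⟨hγ⟩
  obtain ⟨he, hf⟩ := degreeOne_of_splitsIn hK.1.1 hsplit h𝔭
  have hIW := imcLowerWaldspurgerOnTreeAt_of_imcDivIntFrameAtErratumDataB hGZK hnf hPT hEP ι hD Dt H
    ιK hE hr hqp hmq hns hvq hK hCas hP hc hinf hκ γ 𝔭 h𝔭 he hf
  have hCTL := controlUpperOnTreeAt_of_isErratumField hGZK hnf hPT hEP hr hE.2.1 hE.2.2.1 hqp hK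
    hinf hκ γ 𝔭 h𝔭 he hf
  have h := two_mul_index_le_of_onTreeUpperLinks hIW hCTL
  rw [padicValNat_tamagawaProductSplit_eq_of_isErratumField W p K hE.1 q hmq hvq hK] at h
  omega

end Pointwise

end Summit.BirchSwinnertonDyer.Rank1Residual.X11b

end
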